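import Mathlib
import HarnessLib
import Summits.ValiantsHypothesis.Statement
import Literature.Computability.AlgebraicComplexity.EquivariantDC
import Literature.Computability.AlgebraicComplexity.LandsbergRessayre
import Literature.Computability.AlgebraicComplexity.LandsbergRessayreProofs
import Literature.Computability.AlgebraicComplexity.DeterminantalComplexity
import Literature.Computability.AlgebraicComplexity.DeterminantalComplexityProofs
import Literature.Computability.AlgebraicComplexity.PermanentVsDeterminant
import Literature.Computability.AlgebraicComplexity.BLMW11WeakValiantHypothesis
import Literature.Computability.AlgebraicComplexity.ValiantConjectureEquivProofs
import Literature.Computability.AlgebraicComplexity.ValiantClasses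
import Literature.Computability.AlgebraicComplexity.ValiantClassesProofs
import Literature.Computability.AlgebraicComplexity.RazElusiveGeneralProofs
import Literature.Computability.AlgebraicComplexity.StandardFamilies
import Summits.ValiantsHypothesis.ValiantsHypothesis.Theorems.DefinabilityGapCollapseToVPwsBare

/-!
# Equivariant-dc dial (decomp-valiant workshop, lens 1 «representation-theoretic obstruction
# splitting», generation 12) — kernel certificate of a census cell and a dial; NOT a route

Census instrument of the decomposition workshop (cycle 1 = Valiant), seat `decomp-val-lens-1`, filed as a
support certificate (critic ruling STATUS 786: «publish as NODE + census cell; kernel file may land as a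
Theorems/ support certificate»).  It supports the shared item `CollapseToVPws` (stmt-ValiantsHypothesis-23702,
route `DefinabilityGap`) WITHOUT closing it.  Honest framing: `VP ≠ VNP` is NOT proved and nothing here is
progress on it; every statement below is a decomposition identity or a calibration fact.

THE CELL `EqHardBiPerm` (A): no polynomial-size family of affine determinantal representations of `per_m`
with EXACT `GL_s × GL_s` lifts of the bi-permutation substitutions `x_ij ↦ x_{σ i, τ j}` (window
`H_m = 𝔖_m × 𝔖_m`, NO torus) — the restricted-model lower bound at the torus-free notch that Landsberg
flags as open (*Geometry and Complexity Theory* 2017, p. 194: "I do not know just how large the symmetry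
group needs to be to obtain an exponential bound"); Landsberg–Ressayre (arXiv:1508.05788, Thm 2.8) prove it
for every `H ⊇ N(T^E)` (torus present; tree `lr_left_equivariant_lower_holds`), Dawar–Wilsenach (ToC 21
(2025) art. 14, Cor. 7.12) prove `2^{Ω(m)}` for conjugation-by-permutation lifts only.  `S ⟹ W ⟹ A`
(kernels below); `A ⟹ W`, `A ⟹ S` are not known.

THE DIAL (LESSON 6 of the workshop, exact at every notch): for a symmetry-subgroup family `H`,
`W ⟺ EqHard H ∧ SymCheap H` (`dcPerSuperpolynomial_iff_split`) where `W := DcPerSuperpolynomial ℂ`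
(`VP_ws ≠ VNP`), `EqHard H` = no polynomial `H`-equivariant family, `SymCheap H` = «if `dc(per)` is
polynomially bounded then a polynomial `H`-equivariant family exists»; `EqHard` is monotone and `SymCheap`
antitone in `H`; TOP `H ⊇ N(T^E)`: `EqHard` PROVED (`eqHard_of_leftMonomial_le`) so `SymCheap ⟺ W`;
BOTTOM `H = 1`: `SymCheap` PROVED (`symCheap_bot`) so `EqHard ⟺ W`; sliding `H` moves `W` between the two
pieces and nothing else (`symCheap_iff_residual : SymCheap H ⟺ (EqHard H → W)` — the piece `SymCheap` is
the BARE residual of `EqHard` relative to `W`, census tag DECLARED-RESIDUAL·BARE).  The window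
`biPermSubst` sits inside Landsberg–Ressayre's realised symmetry group (`biPermSubst_le_permSymmetrySubst`,
so their pairs representation of size `C(2m,m) - 1` witnesses the inner existential of `A` at exponential
size: `A` is not vacuously typed).

SUMMIT LEVEL: `S ⟺ EqHardBiPerm ∧ BiPermSymCheap ∧ CollapseToVPws` (`summit_iff_split`), with
`BiPermSymCheap ⟺ (EqHardBiPerm → W)` and `CollapseToVPws ⟺ (W → S)` (lens 5,
`DefinabilityGapCollapseToVPwsBare.collapseToVPws_iff_dc`), and `(EqHardBiPerm → S) ⟺
BiPermSymCheap ∧ CollapseToVPws` (`bare_iff_residuals`): both non-`A` pieces are bare residuals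
(relative to `W`, resp. `S`); the node's content is the cell `A` and the dial.

References: [LandsbergRessayre2017] arXiv:1508.05788 Question 2.2, Cor. 2.3, Thm 2.8, Prop. 2.10, §6;
[Landsberg2017] CUP, §7.4, p. 194; [DawarWilsenach2025] Theory of Computing 21, art. 14, §7.4, Cor. 7.12;
[BurgisserLandsbergManivelWeyman2011] §9.2 (`S ⟹ W`, tree `dcPerSuperpolynomial_of_perNotPComputableComplex`).
-/

-- lint debt (as every `Summit.ValiantsHypothesis.ValiantsHypothesis.Theorems.*` file): the mandated namespace repeats a component.
set_option linter.dupNamespace false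

namespace Summit.ValiantsHypothesis.ValiantsHypothesis.Theorems.EquivariantDialNode

open MvPolynomial Literature.Computability.AlgebraicComplexity
open scoped Kronecker
open Summit.ValiantsHypothesis.ValiantsHypothesis.Theses.DefinabilityGap (CollapseToVPws)

/-! ## The two window pieces (one-line Props over existing declarations; `CollapseToVPws` is the route decl of lens 5) -/

/-- CELL A · WEAKER (S ⟹ W ⟹ A, kernels `dcPerSuperpolynomial_of_summit`,
`eqHardBiPerm_of_summit`; A ⟹ W and A ⟹ S NOT known) · ATTACKABLE (restricted-model lower bound:
Landsberg 2017 p.194 open question; rungs LR17 Thm 2.8 kernel, DW25 Cor 7.12 print) · INSTRUMENTABLE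
(`edc_{𝔖_3×𝔖_3}(per_3)` vs `dc(per_3)=7` is a finite algebra problem).
No polynomial-size family of BI-PERMUTATION-EQUIVARIANT affine determinantal representations of the
permanent: there is no `c` such that every `per_m` has an `𝔖_m × 𝔖_m`-equivariant (exact
`GL_s × GL_s` lifts) representation of some size `s ≤ m^c + c`. -/
def EqHardBiPerm : Prop :=
  ¬ ∃ c : ℕ, ∀ m : ℕ, ∃ s : ℕ, s ≤ m ^ c + c ∧ Literature.Computability.AlgebraicComplexity.HasEquivariantDetRepr (Subgroup.closure {γ : Matrix.GeneralLinearGroup (Fin m × Fin m) ℂ | ∃ σ τ : Equiv.Perm (Fin m), (γ : Matrix (Fin m × Fin m) (Fin m × Fin m) ℂ) = Equiv.Perm.permMatrix ℂ (Equiv.prodCongr σ τ)}) (Literature.Computability.AlgebraicComplexity.perPoly (Fin m) ℂ) s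

/-- piece L · DECLARED-RESIDUAL · BARE relative to `W` (L ⟺ (A → W), kernel `biPermSymCheap_iff_residual`;
critic ruling STATUS 786) · WEAKER (W ⟹ L vacuously, kernel `biPermSymCheap_of_summit`; L ⟹ S not known) · UNDECIDED (test: PROVED by any
polynomial-cost 𝔖_m × 𝔖_m symmetrisation of ABPs / determinantal representations of `per`
— Landsberg 2017 p.194 second bullet, a weakening of Landsberg–Ressayre Question 2.2 at the group
𝔖_m × 𝔖_m (`biPermSymCheap_of_symq`); REFUTED only together with ¬W; instrument:
`edc_{𝔖_m×𝔖_m}(per_m)` against `dc(per_m)` for m = 3, 4) · leaf IDEA-NEEDED.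
If `dc(per_m)` is polynomially bounded then the permanent has a polynomial-size family of
𝔖_m × 𝔖_m-equivariant affine determinantal representations. -/
def BiPermSymCheap : Prop :=
  Literature.Computability.AlgebraicComplexity.IsPBounded (fun m => Literature.Computability.AlgebraicComplexity.determinantalComplexity (Literature.Computability.AlgebraicComplexity.perPoly (Fin m) ℂ)) → ∃ c : ℕ, ∀ m : ℕ, ∃ s : ℕ, s ≤ m ^ c + c ∧ Literature.Computability.AlgebraicComplexity.HasEquivariantDetRepr (Subgroup.closure {γ : Matrix.GeneralLinearGroup (Fin m × Fin m) ℂ | ∃ σ τ : Equiv.Perm (Fin m), (γ : Matrix (Fin m × Fin m) (Fin m × Fin m) ℂ) = Equiv.Perm.permMatrix ℂ (Equiv.prodCongr σ τ)}) (Literature.Computability.AlgebraicComplexity.perPoly (Fin m) ℂ) s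

/-! ## The dial, generic in the symmetry subgroup family `H` -/

section Dial

variable (H H' : ∀ m : ℕ, Subgroup (GL (Fin m × Fin m) ℂ))

/-- The permanent has a polynomial-size family of `H_m`-equivariant affine determinantal
representations. -/
def PolyEquivariant : Prop :=
  ∃ c : ℕ, ∀ m : ℕ, ∃ s : ℕ, s ≤ m ^ c + c ∧ HasEquivariantDetRepr (H m) (perPoly (Fin m) ℂ) s

/-- Piece A at the notch `H`: equivariant hardness. -/
def EqHard : Prop := ¬ PolyEquivariant H

/-- Piece L at the notch `H`: symmetrisation at polynomial cost in the polynomial-`dc` world. -/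
def SymCheap : Prop :=
  IsPBounded (fun m => determinantalComplexity (perPoly (Fin m) ℂ)) → PolyEquivariant H

/-- The WINDOW group: bi-permutation substitutions `x_{ij} ↦ x_{σ i, τ j}` of the `m²` variables
(`𝔖_m × 𝔖_m ≤ G_{per_m}`, no torus, no transposition), as a subgroup of `GL(m²)`. -/
def biPermSubst (m : ℕ) : Subgroup (GL (Fin m × Fin m) ℂ) :=
  Subgroup.closure {γ : GL (Fin m × Fin m) ℂ | ∃ σ τ : Equiv.Perm (Fin m),
    (γ : Matrix (Fin m × Fin m) (Fin m × Fin m) ℂ) = Equiv.Perm.permMatrix ℂ (Equiv.prodCongr σ τ)}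

/-- The cell is the dial's `EqHard` at the window (definitional). -/
theorem eqHardBiPerm_iff : EqHardBiPerm ↔ EqHard biPermSubst := Iff.rfl

/-- Piece `L` is the dial's `SymCheap` at the window (definitional). -/
theorem biPermSymCheap_iff : BiPermSymCheap ↔ SymCheap biPermSubst := Iff.rfl

variable {H H'}

/-- A polynomial-size equivariant family bounds `dc(per_m)` polynomially (forget the symmetry). -/
theorem PolyEquivariant.isPBounded (h : PolyEquivariant H) :
    IsPBounded (fun m => determinantalComplexity (perPoly (Fin m) ℂ)) := by
  obtain ⟨c, hc⟩ := h
  refine ⟨c, fun m => ?_⟩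
  obtain ⟨s, hs, A, hA⟩ := hc m
  exact (determinantalComplexity_le_of_hasDetRepr ⟨A, hA.isAffineDetRepr⟩).trans hs

/-- Fewer symmetries are easier to respect. -/
theorem PolyEquivariant.anti (h : PolyEquivariant H) (hle : ∀ m, H' m ≤ H m) : PolyEquivariant H' := by
  obtain ⟨c, hc⟩ := h
  refine ⟨c, fun m => ?_⟩
  obtain ⟨s, hs, hA⟩ := hc m
  exact ⟨s, hs, hA.anti (hle m)⟩

/-- Piece A is MONOTONE up the dial: more symmetry, more hardness. -/
theorem EqHard.mono (h : EqHard H) (hle : ∀ m, H m ≤ H' m) : EqHard H' :=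
  fun h' => h (h'.anti hle)

/-- Piece L is ANTITONE: less symmetry, cheaper symmetrisation. -/
theorem SymCheap.anti (h : SymCheap H) (hle : ∀ m, H' m ≤ H m) : SymCheap H' :=
  fun hb => (h hb).anti hle

/-- `W ⟹ A` at every notch. -/
theorem eqHard_of_dcPerSuperpolynomial (h : DcPerSuperpolynomial ℂ) : EqHard H :=
  fun hP => h hP.isPBounded

/-- `W ⟹ L` at every notch (vacuously). -/
theorem symCheap_of_dcPerSuperpolynomial (h : DcPerSuperpolynomial ℂ) : SymCheap H :=
  fun hb => absurd hb h

/-- `A ∧ L ⟹ W` at every notch. -/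
theorem dcPerSuperpolynomial_of_split (hA : EqHard H) (hL : SymCheap H) : DcPerSuperpolynomial ℂ :=
  fun hb => hA (hL hb)

variable (H) in
/-- THE `W`-NODE: Valiant's determinantal conjecture splits, at every notch of the dial, as
equivariant hardness AND cheap symmetrisation. -/
theorem dcPerSuperpolynomial_iff_split : DcPerSuperpolynomial ℂ ↔ EqHard H ∧ SymCheap H :=
  ⟨fun h => ⟨eqHard_of_dcPerSuperpolynomial h, symCheap_of_dcPerSuperpolynomial h⟩,
    fun h => dcPerSuperpolynomial_of_split h.1 h.2⟩

variable (H) in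
/-- `L` is exactly the residual of `A` RELATIVE TO `W` (not relative to the summit). -/
theorem symCheap_iff_residual : SymCheap H ↔ (EqHard H → DcPerSuperpolynomial ℂ) := by
  constructor
  · intro hL hA hb
    exact hA (hL hb)
  · intro h hb
    by_contra hP
    exact h hP hb

/-- Where `A` is a theorem, `L` carries all of `W` (zero-sum end of the dial). -/
theorem symCheap_iff_W_of_eqHard (hA : EqHard H) : SymCheap H ↔ DcPerSuperpolynomial ℂ :=
  ⟨fun hL => dcPerSuperpolynomial_of_split hA hL, symCheap_of_dcPerSuperpolynomial⟩

/-- Where `L` is a theorem, `A` carries all of `W` (the other zero-sum end). -/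
theorem eqHard_iff_W_of_symCheap (hL : SymCheap H) : EqHard H ↔ DcPerSuperpolynomial ℂ :=
  ⟨fun hA => dcPerSuperpolynomial_of_split hA hL, eqHard_of_dcPerSuperpolynomial⟩

/-- Piece `L` is a WEAKENING of Landsberg–Ressayre's Question 2.2 asked at the group `H`
(a uniform polynomial relation `edc_H(per_m) ≤ e(dc(per_m))`; LR17 Cor. 2.3 = tree `lr_cor_2_3`
is the full-symmetry instance of `symq ⟹ W`). -/
theorem symCheap_of_symq
    (hQ : ∃ c : ℕ, ∀ m : ℕ, ∃ s : ℕ, s ≤ determinantalComplexity (perPoly (Fin m) ℂ) ^ c + c ∧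
      HasEquivariantDetRepr (H m) (perPoly (Fin m) ℂ) s) :
    SymCheap H := by
  intro hb
  obtain ⟨c, hc⟩ := hQ
  have ht : IsPBounded fun m => determinantalComplexity (perPoly (Fin m) ℂ) ^ c + c :=
    IsPBounded.add_holds (IsPBounded.pow_holds hb c) (IsPBounded.const c)
  obtain ⟨c', hc'⟩ := ht
  refine ⟨c', fun m => ?_⟩
  obtain ⟨s, hs, hA⟩ := hc m
  exact ⟨s, hs.trans (hc' m), hA⟩

/-! ### Calibration: the two ends of the dial are theorems -/

/-- TOP (Landsberg–Ressayre 2017, Thm 2.8; PROVED in the tree as `lr_left_equivariant_lower_holds`):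
every notch containing the left torus-normaliser `N(T^E) = T^E ⋊ 𝔖_m` (for `m ≥ 3`) is HARD —
`2^m − 1 ≤ s` beats every `m^c + c`. -/
theorem eqHard_of_leftMonomial_le (hle : ∀ m, 3 ≤ m → leftMonomialSubst ℂ m ≤ H m) : EqHard H := by
  rintro ⟨c, hc⟩
  obtain ⟨T, hT⟩ := eventually_mul_pow_lt_two_pow c 4
  set m : ℕ := max (max T 3) c with hm_def
  have hmT : T ≤ m := le_trans (le_max_left _ _) (le_max_left _ _)
  have hm3 : 3 ≤ m := le_trans (le_max_right _ _) (le_max_left _ _)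
  have hmc : c ≤ m := le_max_right _ _
  obtain ⟨s, hs, A, hA⟩ := hc m
  have hlow : 2 ^ m - 1 ≤ s :=
    lr_left_equivariant_lower_holds m hm3 s A (hA.anti (hle m hm3))
  have hgrow : 4 * m ^ c < 2 ^ m := hT m hmT
  have hcpow : c ≤ m ^ c := by
    rcases Nat.eq_zero_or_pos c with h0 | hpos
    · simp [h0]
    · exact hmc.trans (Nat.le_self_pow (Nat.pos_iff_ne_zero.mp hpos) m)
  have hone : 1 ≤ m ^ c := Nat.one_le_pow _ _ (by omega)
  omega

/-- In particular the LR notch itself. -/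
theorem eqHard_leftMonomial : EqHard (fun m => leftMonomialSubst ℂ m) :=
  eqHard_of_leftMonomial_le fun _ _ => le_rfl

/-- And the full realised symmetry group of the permanent (LR17 Thm 2.1 notch). -/
theorem eqHard_permSymmetry : EqHard (fun m => permSymmetrySubst ℂ m) :=
  eqHard_of_leftMonomial_le fun m _ => leftMonomialSubst_le_permSymmetrySubst ℂ m

/-- The WINDOW plus the left torus-normaliser is already a theorem: what the window lacks is
exactly the TORUS. -/
theorem eqHard_biPerm_sup_leftMonomial : EqHard (fun m => biPermSubst m ⊔ leftMonomialSubst ℂ m) :=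
  eqHard_of_leftMonomial_le fun _ _ => le_sup_right

/-- Hence at the LR notch the conditional piece is the whole of `W` (costume end). -/
theorem symCheap_leftMonomial_iff :
    SymCheap (fun m => leftMonomialSubst ℂ m) ↔ DcPerSuperpolynomial ℂ :=
  symCheap_iff_W_of_eqHard eqHard_leftMonomial

/-- BOTTOM: with no symmetry imposed, symmetrisation is free (`dc` is attained). -/
theorem symCheap_bot : SymCheap (fun m => (⊥ : Subgroup (GL (Fin m × Fin m) ℂ))) := by
  rintro ⟨c, hc⟩
  refine ⟨c, fun m => ⟨determinantalComplexity (perPoly (Fin m) ℂ), hc m, ?_⟩⟩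
  exact hasEquivariantDetRepr_bot_iff.mpr (hasDetRepr_determinantalComplexity_holds _)

/-- Hence at the bottom the hardness piece is the whole of `W` (the other costume end). -/
theorem eqHard_bot_iff :
    EqHard (fun m => (⊥ : Subgroup (GL (Fin m × Fin m) ℂ))) ↔ DcPerSuperpolynomial ℂ :=
  eqHard_iff_W_of_symCheap symCheap_bot

/-! ### Where the window sits: `𝔖_m × 𝔖_m ≤ 𝔾_per` (realised), hence window representations EXIST -/

/-- The bi-permutation substitution matrix is the Kronecker product of the two permutation matrices. -/
theorem permMatrix_prodCongr {m : ℕ} (σ τ : Equiv.Perm (Fin m)) :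
    Equiv.Perm.permMatrix ℂ (Equiv.prodCongr σ τ) = σ.permMatrix ℂ ⊗ₖ τ.permMatrix ℂ := by
  ext ⟨i, j⟩ ⟨i', j'⟩
  simp only [Equiv.Perm.permMatrix, Matrix.kroneckerMap_apply, PEquiv.toMatrix_apply,
    Equiv.toPEquiv_apply, Option.mem_def, Option.some.injEq, Equiv.prodCongr_apply, Prod.map,
    Prod.mk.injEq]
  split_ifs <;> simp_all

/-- Permutation matrices are invertible over `ℂ`. -/
theorem det_permMatrix_ne_zero {m : ℕ} (σ : Equiv.Perm (Fin m)) : (σ.permMatrix ℂ).det ≠ 0 := by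
  rw [Matrix.det_permutation]
  rcases Int.units_eq_one_or (Equiv.Perm.sign σ) with h | h <;> simp [h]

/-- The permutation matrix `P_σ` as an element of `GL_m(ℂ)`. -/
noncomputable def permGL {m : ℕ} (σ : Equiv.Perm (Fin m)) : GL (Fin m) ℂ :=
  Matrix.GeneralLinearGroup.mkOfDetNeZero (σ.permMatrix ℂ) (det_permMatrix_ne_zero σ)

/-- The underlying matrix of `permGL σ` is the permutation matrix. -/
@[simp] theorem coe_permGL {m : ℕ} (σ : Equiv.Perm (Fin m)) :
    ((permGL σ : GL (Fin m) ℂ) : Matrix (Fin m) (Fin m) ℂ) = σ.permMatrix ℂ := rfl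

/-- Permutation matrices are monomial (tree `monomialSubgroup` = permutation × invertible diagonal). -/
theorem permGL_mem_monomialSubgroup {m : ℕ} (σ : Equiv.Perm (Fin m)) :
    permGL σ ∈ monomialSubgroup ℂ m :=
  Subgroup.subset_closure (Or.inl ⟨σ, rfl⟩)

/-- **The window is a subgroup of the realised symmetry group of the permanent** (LR17 §2.1, tree
`permSymmetrySubst`): `P_σ ⊗ P_τ = (P_σ ⊗ 1)(1 ⊗ P_τ)` with both factors monomial. -/
theorem biPermSubst_le_permSymmetrySubst (m : ℕ) : biPermSubst m ≤ permSymmetrySubst ℂ m := by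
  rw [biPermSubst, Subgroup.closure_le]
  rintro γ ⟨σ, τ, hγ⟩
  let γ₁ : GL (Fin m × Fin m) ℂ := Matrix.GeneralLinearGroup.kronecker (permGL σ) 1
  let γ₂ : GL (Fin m × Fin m) ℂ := Matrix.GeneralLinearGroup.kronecker 1 (permGL τ)
  have h₁ : (γ₁ : Matrix (Fin m × Fin m) (Fin m × Fin m) ℂ) =
      σ.permMatrix ℂ ⊗ₖ (1 : Matrix (Fin m) (Fin m) ℂ) := rfl
  have h₂ : (γ₂ : Matrix (Fin m × Fin m) (Fin m × Fin m) ℂ) =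
      (1 : Matrix (Fin m) (Fin m) ℂ) ⊗ₖ τ.permMatrix ℂ := rfl
  have hγeq : γ = γ₁ * γ₂ := Units.ext (by
    rw [Units.val_mul, h₁, h₂, ← Matrix.mul_kronecker_mul, Matrix.mul_one, Matrix.one_mul, hγ,
      permMatrix_prodCongr])
  rw [SetLike.mem_coe, hγeq]
  refine Subgroup.mul_mem _ ?_ ?_
  · refine Subgroup.subset_closure (Or.inl (Or.inl ?_))
    exact Subgroup.subset_closure ⟨permGL σ, permGL_mem_monomialSubgroup σ, h₁⟩
  · refine Subgroup.subset_closure (Or.inl (Or.inr ?_))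
    exact Subgroup.subset_closure ⟨permGL τ, permGL_mem_monomialSubgroup τ, h₂⟩

/-- Hence **window-equivariant representations exist whenever fully equivariant ones do**: with the
Landsberg–Ressayre pairs representation (LR17 Prop. 2.10, in the tree as
`LRPairs.hasEquivariantDetRepr_perPoly_permSymmetrySubst`, size `C(2m,m) - 1`, `m ≥ 1`; not imported here to
keep this file's import cone small) the inner existential of `EqHardBiPerm` is witnessed at every `m`, so the
cell is a GROWTH statement (`dc(per_m) ≤ edc_window(per_m) ≤ C(2m,m) - 1`), not true by absence of witnesses.
[cite: LandsbergRessayre2017, Prop. 2.10] -/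
theorem hasEquivariantDetRepr_window_of_full {m s : ℕ}
    (h : HasEquivariantDetRepr (permSymmetrySubst ℂ m) (perPoly (Fin m) ℂ) s) :
    HasEquivariantDetRepr (biPermSubst m) (perPoly (Fin m) ℂ) s :=
  h.anti (biPermSubst_le_permSymmetrySubst m)

/-- In dial terms: hardness in the window transfers UP to the full symmetry group (where it is LR Thm 2.1),
never down — the window is a genuine intermediate notch `1 < 𝔖_m × 𝔖_m < 𝔾_per`. -/
theorem eqHard_permSymmetry_of_window (h : EqHard biPermSubst) : EqHard (fun m => permSymmetrySubst ℂ m) :=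
  h.mono fun m => biPermSubst_le_permSymmetrySubst m

end Dial

/-! ## Summit level: deciding theorem, necessity of every piece, the AND-node -/

/-- `S ⟹ W` (BLMW11 §9.2, tree). -/
theorem dcPerSuperpolynomial_of_summit (hS : _root_.ValiantsHypothesis) : DcPerSuperpolynomial ℂ :=
  dcPerSuperpolynomial_of_perNotPComputableComplex (perNotPComputableComplex_iff_holds.mpr hS)

/-- `A ∧ L ∧ R ⟹ S` (the AND-node is sufficient). -/
theorem summit_of_split (hA : EqHardBiPerm) (hL : BiPermSymCheap) (hR : CollapseToVPws) :
    _root_.ValiantsHypothesis :=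
  DefinabilityGapCollapseToVPwsBare.collapseToVPws_iff_dc.mp hR (dcPerSuperpolynomial_of_split (H := biPermSubst) hA hL)

/-- `W ⟺ A ∧ L` at the window. -/
theorem dcPerSuperpolynomial_iff_window : DcPerSuperpolynomial ℂ ↔ EqHardBiPerm ∧ BiPermSymCheap :=
  dcPerSuperpolynomial_iff_split biPermSubst

/-- `S ⟹ A`. -/
theorem eqHardBiPerm_of_summit (hS : _root_.ValiantsHypothesis) : EqHardBiPerm :=
  eqHard_of_dcPerSuperpolynomial (H := biPermSubst) (dcPerSuperpolynomial_of_summit hS)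

/-- `S ⟹ L`. -/
theorem biPermSymCheap_of_summit (hS : _root_.ValiantsHypothesis) : BiPermSymCheap :=
  symCheap_of_dcPerSuperpolynomial (H := biPermSubst) (dcPerSuperpolynomial_of_summit hS)

/-- THE NODE: `S ⟺ A ∧ L ∧ R`. -/
theorem summit_iff_split :
    _root_.ValiantsHypothesis ↔ EqHardBiPerm ∧ BiPermSymCheap ∧ CollapseToVPws :=
  ⟨fun hS => ⟨eqHardBiPerm_of_summit hS, biPermSymCheap_of_summit hS,
      DefinabilityGapCollapseToVPwsBare.collapseToVPws_of_vh hS⟩,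
    fun h => summit_of_split h.1 h.2.1 h.2.2⟩

/-- `L ⟺ (A → W)`: the residual of `A` relative to `W`. -/
theorem biPermSymCheap_iff_residual : BiPermSymCheap ↔ (EqHardBiPerm → DcPerSuperpolynomial ℂ) :=
  symCheap_iff_residual biPermSubst

/-- Residual descent certificate: the BARE residual `A → S` implies both `L` and `R`
(so each of them is weaker-or-equal; `L ⟺ (A → S)` would need `W → S`, `R ⟺ (A → S)` would need
`A → W`, i.e. `L` itself — neither is known). -/
theorem residuals_of_bare (h : EqHardBiPerm → _root_.ValiantsHypothesis) :
    BiPermSymCheap ∧ CollapseToVPws :=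
  ⟨biPermSymCheap_iff_residual.mpr fun hA => dcPerSuperpolynomial_of_summit (h hA),
    DefinabilityGapCollapseToVPwsBare.collapseToVPws_iff_dc.mpr fun hW => h (eqHard_of_dcPerSuperpolynomial (H := biPermSubst) hW)⟩

/-- Conversely `L ∧ R` give back the bare residual, so `(A → S) ⟺ L ∧ R`: the node's residual is
SPLIT, not renamed. -/
theorem bare_iff_residuals :
    (EqHardBiPerm → _root_.ValiantsHypothesis) ↔ BiPermSymCheap ∧ CollapseToVPws :=
  ⟨residuals_of_bare, fun h hA => summit_of_split hA h.1 h.2⟩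

end Summit.ValiantsHypothesis.ValiantsHypothesis.Theorems.EquivariantDialNode
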